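import Summits.CriticalPhenomena.PercolationContinuityZ3.Theorems.PercNearOneGluingNoHeavyLowerTailSahiCombFiveUpSetRankA

/-!
# The five-up-set inequality, RANK route IV: the inequality (♠_a⁺) for monotone families over any bounded index poset

Support file of the one-cut programme (crux `NoHeavyLowerTail`, stmt-CriticalPhenomena-4575; cell `prim-masterthm` seat P5, gen 9;
memo `FROM-prim-masterthm-p5-g9-RANKZA-CERT.md`, report `P5-LORENTZIAN-TEST.md` §14.2).  The counting consequence of
`rankZA_kernel_eq_zero_of_upperSet` (`…SahiCombFiveUpSetRankA`):

* **`spadeAPlus_ineq`** — for a finite bounded index poset `ι` with `⊥ ≠ ⊤`, monotone families `F, G : ι → up-sets of the cube`,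
  and an up-set `P`:
  `#(P ∩ F ⊤ ∩ refl(G ⊥)) + #(P ∩ G ⊤ ∩ refl(F ⊥)) + Σ_y #(P ∩ (refl(F y ∩ G y) \ (refl(F ⊥) ∪ refl(G ⊥)))) ≤ Σ_y #(P ∩ F y ∩ G y)`.
  In the language of report §11.10/§14 (`U_y = F_y ∩ G_y`, `R` = complementation): one copy of the supplies `⊔_y (P ∩ U_y)` receives,
  along the product order of `ι × 2^α`, the demands `P ∩ F_⊤ ∩ RG_⊥`, `P ∩ G_⊤ ∩ RF_⊥` and, at every level `y`, the reflected supplies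
  `P ∩ R(U_y ∖ (F_⊥ ∪ G_⊥))`.  For `ι = {⊥ < ⊤}` this is the five-up-set inequality (`fiveUpSetIneq_holds`); for `ι = 2^a` it dominates
  the one-copy inequality (♠_a) `Σ_x #(P ∩ U_x) ≥ #(P ∩ F_⊤ ∩ RG_⊥) + #(P ∩ RF_⊥ ∩ G_⊤) + Σ_{w ∈ P} κ(α(Rw), β(Rw))` of the memo.
  PROOF: the demand vectors `(d,⊤) ↦ ([y = ⊤][d ⊆ t])_{(y,t)}`, `(d,⊥) ↦ ([d ⊆ t])`, `(d,x) ↦ ([x ≤ y][d ⊆ t])` in `ℚ^{Σ_y (P ∩ U_y)}`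
  are linearly independent by the kernel theorem, hence at most the dimension in number.
HONEST LABEL: complete proof, std axioms.  It is NOT a proof of `TRI_W(a) ≥ 0` for `a ≥ 2` (report §14.2). [this work]
-/

namespace Summit.CriticalPhenomena.PercolationContinuityZ3.Theorems

namespace FiveUpSet

open Finset

variable {α : Type*} [DecidableEq α] [Fintype α]
variable {ι : Type*} [PartialOrder ι] [Fintype ι] [DecidableEq ι] [OrderBot ι] [OrderTop ι]
  [DecidableRel ((· ≤ ·) : ι → ι → Prop)]

/-- **(♠_a⁺)** — the counting form of (RANK-Z_a⁺).  For a finite bounded index poset `ι` (`⊥ ≠ ⊤`), monotone families `F, G` of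
up-sets of the cube `Finset α` and an up-set `P`:
`#(P ∩ F ⊤ ∩ refl (G ⊥)) + #(P ∩ G ⊤ ∩ refl (F ⊥)) + Σ_y #(P ∩ (refl (F y ∩ G y) \ (refl (F ⊥) ∪ refl (G ⊥)))) ≤ Σ_y #(P ∩ F y ∩ G y)`.
[this work] -/
theorem spadeAPlus_ineq (hι : (⊥ : ι) ≠ ⊤) (P : Finset (Finset α)) (F G : ι → Finset (Finset α))
    (hP : IsUpperSet (P : Set (Finset α)))
    (hF : ∀ x, IsUpperSet (F x : Set (Finset α))) (hG : ∀ x, IsUpperSet (G x : Set (Finset α)))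
    (hFm : Monotone F) (hGm : Monotone G) :
    (P ∩ F ⊤ ∩ refl (G ⊥)).card + (P ∩ G ⊤ ∩ refl (F ⊥)).card +
        ∑ y, (P ∩ (refl (F y ∩ G y) \ (refl (F ⊥) ∪ refl (G ⊥)))).card ≤ ∑ y, (P ∩ F y ∩ G y).card := by
  -- demand index sets
  set D₁ : Finset (Finset α) := P ∩ F ⊤ ∩ refl (G ⊥) with hD₁
  set D₂ : Finset (Finset α) := P ∩ G ⊤ ∩ refl (F ⊥) with hD₂
  -- the demand vectors in `ℚ^{Σ y, T y}`
  have hli : LinearIndependent ℚ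
      (Sum.elim
        (fun d : ↥D₁ => fun s : (Σ y, ↥(P ∩ F y ∩ G y)) =>
          if s.1 = ⊤ then (if (d : Finset α) ⊆ (s.2 : Finset α) then (1 : ℚ) else 0) else 0)
        (Sum.elim
          (fun d : ↥D₂ => fun s : (Σ y, ↥(P ∩ F y ∩ G y)) => if (d : Finset α) ⊆ (s.2 : Finset α) then (1 : ℚ) else 0)
          (fun xd : (Σ x, ↥(P ∩ (refl (F x ∩ G x) \ (refl (F ⊥) ∪ refl (G ⊥))))) => fun s : (Σ y, ↥(P ∩ F y ∩ G y)) =>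
            if xd.1 ≤ s.1 then (if (xd.2 : Finset α) ⊆ (s.2 : Finset α) then (1 : ℚ) else 0) else 0))) := by
    rw [Fintype.linearIndependent_iff]
    intro g hg
    -- coefficient vectors on the cube
    obtain ⟨a, ha⟩ : ∃ f : Finset α → ℚ, ∀ d, f d = if h : d ∈ D₁ then g (Sum.inl ⟨d, h⟩) else 0 := ⟨_, fun _ => rfl⟩
    obtain ⟨b, hb⟩ : ∃ f : Finset α → ℚ, ∀ d, f d = if h : d ∈ D₂ then g (Sum.inr (Sum.inl ⟨d, h⟩)) else 0 :=
      ⟨_, fun _ => rfl⟩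
    obtain ⟨c, hc⟩ : ∃ f : ι → Finset α → ℚ, ∀ x d,
        f x d = if h : d ∈ P ∩ (refl (F x ∩ G x) \ (refl (F ⊥) ∪ refl (G ⊥))) then g (Sum.inr (Sum.inr ⟨x, ⟨d, h⟩⟩)) else 0 := ⟨fun x d => _, fun _ _ => rfl⟩
    have hasupp : ∀ d, a d ≠ 0 → d ∈ D₁ := by
      intro d hd; by_contra h'; rw [ha d, dif_neg h'] at hd; exact hd rfl
    have hbsupp : ∀ d, b d ≠ 0 → d ∈ D₂ := by
      intro d hd; by_contra h'; rw [hb d, dif_neg h'] at hd; exact hd rfl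
    have hcsupp : ∀ x d, c x d ≠ 0 → d ∈ P ∩ (refl (F x ∩ G x) \ (refl (F ⊥) ∪ refl (G ⊥))) := by
      intro x d hd; by_contra h'; rw [hc x d, dif_neg h'] at hd; exact hd rfl
    -- sums over the index finsets are sums over the cube
    have suma : ∀ t : Finset α, ∑ d : ↥D₁, g (Sum.inl d) * (if (d : Finset α) ⊆ t then (1 : ℚ) else 0)
        = ∑ d, a d * (if d ⊆ t then (1 : ℚ) else 0) := by
      intro t
      have h1 : ∑ d, a d * (if d ⊆ t then (1 : ℚ) else 0) = ∑ d ∈ D₁, a d * (if d ⊆ t then (1 : ℚ) else 0) := by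
        refine (Finset.sum_subset (subset_univ _) ?_).symm
        intro d _ hd; rw [ha d, dif_neg hd, zero_mul]
      rw [h1]
      conv_rhs => rw [← Finset.sum_coe_sort]
      refine Finset.sum_congr rfl fun d _ => ?_
      rw [ha d, dif_pos d.2]
    have sumb : ∀ t : Finset α, ∑ d : ↥D₂, g (Sum.inr (Sum.inl d)) * (if (d : Finset α) ⊆ t then (1 : ℚ) else 0)
        = ∑ d, b d * (if d ⊆ t then (1 : ℚ) else 0) := by
      intro t
      have h1 : ∑ d, b d * (if d ⊆ t then (1 : ℚ) else 0) = ∑ d ∈ D₂, b d * (if d ⊆ t then (1 : ℚ) else 0) := by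
        refine (Finset.sum_subset (subset_univ _) ?_).symm
        intro d _ hd; rw [hb d, dif_neg hd, zero_mul]
      rw [h1]
      conv_rhs => rw [← Finset.sum_coe_sort]
      refine Finset.sum_congr rfl fun d _ => ?_
      rw [hb d, dif_pos d.2]
    have sumc : ∀ x, ∀ t : Finset α,
        ∑ d : ↥(P ∩ (refl (F x ∩ G x) \ (refl (F ⊥) ∪ refl (G ⊥)))), g (Sum.inr (Sum.inr ⟨x, d⟩)) * (if (d : Finset α) ⊆ t then (1 : ℚ) else 0)
        = ∑ d, c x d * (if d ⊆ t then (1 : ℚ) else 0) := by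
      intro x t
      have h1 : ∑ d, c x d * (if d ⊆ t then (1 : ℚ) else 0) = ∑ d ∈ P ∩ (refl (F x ∩ G x) \ (refl (F ⊥) ∪ refl (G ⊥))), c x d * (if d ⊆ t then (1 : ℚ) else 0) := by
        refine (Finset.sum_subset (subset_univ _) ?_).symm
        intro d _ hd; rw [hc x d, dif_neg hd, zero_mul]
      rw [h1]
      conv_rhs => rw [← Finset.sum_coe_sort]
      refine Finset.sum_congr rfl fun d _ => ?_
      rw [hc x d, dif_pos d.2]
    -- the equations of the kernel theorem, read off at the supply token `⟨y, t⟩`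
    have E : ∀ y, ∀ t, t ∈ P → t ∈ F y → t ∈ G y →
        (if y = ⊤ then ∑ d, a d * (if d ⊆ t then (1 : ℚ) else 0) else 0) +
          ∑ d, b d * (if d ⊆ t then (1 : ℚ) else 0) +
          ∑ x, (if x ≤ y then ∑ d, c x d * (if d ⊆ t then (1 : ℚ) else 0) else 0) = 0 := by
      intro y t htP htF htG
      have htT : t ∈ P ∩ F y ∩ G y := mem_inter.2 ⟨mem_inter.2 ⟨htP, htF⟩, htG⟩
      have h0 := congrFun hg ⟨y, ⟨t, htT⟩⟩
      rw [Finset.sum_apply, Fintype.sum_sum_type, Fintype.sum_sum_type, Fintype.sum_sigma] at h0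
      simp only [Pi.smul_apply, smul_eq_mul, Pi.zero_apply, Sum.elim_inl, Sum.elim_inr] at h0
      -- first block
      have hA : ∑ d : ↥D₁, g (Sum.inl d) * (if y = ⊤ then (if (d : Finset α) ⊆ t then (1 : ℚ) else 0) else 0)
          = if y = ⊤ then ∑ d, a d * (if d ⊆ t then (1 : ℚ) else 0) else 0 := by
        by_cases hy : y = ⊤
        · simp only [if_pos hy]; exact suma t
        · simp only [if_neg hy, mul_zero, Finset.sum_const_zero]
      -- third block
      have hC : ∑ x, ∑ d : ↥(P ∩ (refl (F x ∩ G x) \ (refl (F ⊥) ∪ refl (G ⊥)))), g (Sum.inr (Sum.inr ⟨x, d⟩)) *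
            (if x ≤ y then (if (d : Finset α) ⊆ t then (1 : ℚ) else 0) else 0)
          = ∑ x, (if x ≤ y then ∑ d, c x d * (if d ⊆ t then (1 : ℚ) else 0) else 0) := by
        refine Finset.sum_congr rfl fun x _ => ?_
        by_cases hxy : x ≤ y
        · simp only [if_pos hxy]; exact sumc x t
        · simp only [if_neg hxy, mul_zero, Finset.sum_const_zero]
      rw [hA, sumb t, hC, ← add_assoc] at h0
      exact h0
    -- the kernel theorem
    have K := rankZA_kernel_eq_zero_of_upperSet hι P F G hP hF hG hFm hGm a b c ?_ ?_ ?_ E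
    · rintro (⟨d, hd⟩ | ⟨d, hd⟩ | ⟨x, ⟨d, hd⟩⟩)
      · have h0 := K.1 d
        rwa [ha d, dif_pos hd] at h0
      · have h0 := K.2.1 d
        rwa [hb d, dif_pos hd] at h0
      · have h0 := K.2.2 x d
        rwa [hc x d, dif_pos hd] at h0
    · intro d hd
      have h0 := hasupp d hd
      exact ⟨(mem_inter.1 (mem_inter.1 h0).1).1, (mem_inter.1 (mem_inter.1 h0).1).2, mem_refl.1 (mem_inter.1 h0).2⟩
    · intro d hd
      have h0 := hbsupp d hd
      exact ⟨(mem_inter.1 (mem_inter.1 h0).1).1, (mem_inter.1 (mem_inter.1 h0).1).2, mem_refl.1 (mem_inter.1 h0).2⟩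
    · intro x d hd
      have h0 := hcsupp x d hd
      have hdP : d ∈ P := (mem_inter.1 h0).1
      have h3 : d ∈ refl (F x ∩ G x) \ (refl (F ⊥) ∪ refl (G ⊥)) := (mem_inter.1 h0).2
      have h4 : dᶜ ∈ F x ∩ G x := mem_refl.1 (mem_sdiff.1 h3).1
      have h5 : d ∉ refl (F ⊥) ∪ refl (G ⊥) := (mem_sdiff.1 h3).2
      refine ⟨hdP, (mem_inter.1 h4).1, (mem_inter.1 h4).2, ?_, ?_⟩
      · intro h6; exact h5 (mem_union.2 (Or.inl (mem_refl.2 h6)))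
      · intro h6; exact h5 (mem_union.2 (Or.inr (mem_refl.2 h6)))
  -- count: independent vectors are at most the dimension
  have hcard := hli.fintype_card_le_finrank
  rw [Module.finrank_fintype_fun_eq_card, Fintype.card_sigma, Fintype.card_sum, Fintype.card_sum, Fintype.card_sigma,
    Fintype.card_coe, Fintype.card_coe] at hcard
  simp only [Fintype.card_coe] at hcard
  omega

end FiveUpSet

end Summit.CriticalPhenomena.PercolationContinuityZ3.Theorems
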